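import Summits.AtomisticToContinuum.Crystallization.Theorems.PalmUnimodularRigidityMinimiserShellsCapReduction
import Summits.AtomisticToContinuum.Crystallization.Theorems.PalmUnimodularRigidityMinimiserShellsCapEvent
import Summits.AtomisticToContinuum.Crystallization.Theorems.PalmUnimodularRigidityMinimiserShellsDefectTransportSent
import Summits.AtomisticToContinuum.Crystallization.Theorems.PalmUnimodularRigidityMinimiserShellsDefectTransportReceived
import Summits.AtomisticToContinuum.Crystallization.Theorems.PalmUnimodularRigidityMinimiserShellsSurchargedReceived
import Summits.AtomisticToContinuum.Crystallization.Theorems.PalmUnimodularRigidityMinimiserShellsCapAssembly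

/-!
# Sufficiency of the finite cap inequality (line `octahedral-annulus-mandate` of crux `MinimiserShells`,
stmt-AtomisticToContinuum-9225; lead reshape r3)

Route `PalmUnimodularRigidity`, crux decl
`Summit.AtomisticToContinuum.Crystallization.Theses.PalmUnimodularRigidity.MinimiserShells`, lead
`prover-line-stmt-AtomisticToContinuum-9225-c10-0`.

**Theorem** (`capCertificates_of_finiteCapInequality`).  The FINITE, LINEAR CAP INEQUALITY — for every hard core
`δ > 0` some `c > 0` makes every finite injective `δ`-separated cluster `y : Fin N → ℝ³` satisfy
`N·e* + c·#{i : the cluster re-rooted at y i is capless} ≤ 𝓔_N(y)` — implies the CAP CERTIFICATES of the line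
(`Cap.CapCertificates`: for every `δ > 0` a margin `c' > 0` (here `c/2`) such that for every slack `ε > 0` one bounded
finite-range jointly measurable transfer `t` makes `h + div t ≥ e* − ε` at EVERY rooted `δ`-hard-core configuration and
`≥ e* + c'` at every CAPLESS one).

Proof: a DEFECT-SURCHARGED random-grid transport.  Next to the transport of the energy floor (item 9229,
`EnergyFloor.transport`: at a uniformly random phase of the cubic grid of mesh `L` each atom sends
`(local energy + C_δ)/#cell` to every cell-mate) the root sends the surcharge `c/#cell` to every cell-mate whose cell
cluster, re-rooted there, is capless — read through the Giry-measurable proxy of `Capped` on finite counting measures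
(`CapEvent.stub_capEvent`, p132707).  Per phase the surcharge SENT is `c·#capless(cell)/#cell`
(`DefectTransportSent.stub_defectTransportSent`, p132694), the surcharge RECEIVED is `c·1[root capless in its cell]`
(`DefectTransportReceived.stub_defectTransportReceived`, p132821), and the finite inequality applied to the cell
cluster pays for the sent surcharge on top of `e* + C_δ` (`SurchargedReceived.stub_surchargedReceived`, p132892); since
`Capped` reads only atoms of norm `≤ 2` (`Cap.capped_congr_of_local`), "capless in the cell" is "capless" off six phase
slabs of width `2/L`, and the assembly (`CapAssembly.stub_capAssembly`, p133873: `SlackCertificates.certificate_at` with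
the extra transport) gives `h + div t ≥ e* − U/(12·vol) + c(1 − 12/L)·1[capless]`.

**Consequences.**  With the landed necessity `Cap.finite_cap_inequality_of_capPricing` (exact uniform rooting, p131730)
the three forms of the line's tetrahedrally-close-packed-regime energy statement are EQUIVALENT
(`finiteCapInequality_iff_capPricing`, `capCertificates_iff_finiteCapInequality`): measure-level linear pricing of the
capless root event ⇔ pointwise hybrid certificates ⇔ the finite linear cap inequality; and the crux follows from the
finite inequality plus the capped-regime periodic shell gap (`minimiserShells_of_finiteCapInequality`, through
`Cap.cap_reduction`).  What remains OPEN in the line after r3 is exactly `FiniteCapInequality` (its `c > 0`: a universal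
lower bound on the Lennard-Jones landscape of finite clusters at a 4 %·|e*| margin above the TCP competitors; ceiling
`c ≤ 2.98e-2` from capless bct `c/a = 1.06`) and `Cap.CappedRegimeShellGap` (0.06 %-class), both energy statements.
-/

noncomputable section

open MeasureTheory
open scoped ENNReal BigOperators

namespace Summit.AtomisticToContinuum.Crystallization.Theorems.PalmUnimodularRigidityMinimiserShells.CapSufficiency

open Literature.Probability.Process (IsPointStationaryLaw IsRootedHardCore)
open Literature.MathematicalPhysics.StatisticalMechanics (lennardJones rootEnergy interactionEnergy PeriodicConfiguration)
open Summit.AtomisticToContinuum.Crystallization.Theses.PalmUnimodularRigidity (MinimiserShells)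
open Summit.AtomisticToContinuum.Crystallization.Theorems.MinimiserShells.Negative.LoadBearing (eStar meanRootEnergy)
open Summit.AtomisticToContinuum.Crystallization.Theorems.MinimiserShells.Negative.Rootedness (E3)
open Summit.AtomisticToContinuum.Crystallization.Theorems.PalmUnimodularRigidityMinimiserShells.Residual
  (ShellGap IsSepThird)
open Summit.AtomisticToContinuum.Crystallization.Theorems.PalmUnimodularRigidityMinimiserShells.Cap
  (Capped IsTransfer transferDiv caplessMotifCount CapCertificates CapPricing CappedRegimeShellGap
   capPricing_of_capCertificates finite_cap_inequality_of_capPricing cap_reduction capGap_of_capPricing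
   shellGap_zero_of_capPricing)

/-! ## The finite cap inequality -/

/-- **The finite, linear cap inequality** (registered stub `stub_finiteCapInequality` of line
`octahedral-annulus-mandate`, reshape r3; OPEN: the line's energy content in the tetrahedrally-close-packed regime).
For every hard core `δ > 0` some `c > 0` makes every finite injective `δ`-separated cluster `y : Fin N → ℝ³` satisfy
`N·e* + c·#{i : the cluster re-rooted at y i is capless} ≤ 𝓔_N(y)`.  Verbatim the conclusion of
`Cap.finite_cap_inequality_of_capPricing` (necessity); sufficient by `capCertificates_of_finiteCapInequality`. -/
def FiniteCapInequality : Prop :=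
  ∀ δ : ℝ, 0 < δ → ∃ c : ℝ, 0 < c ∧ ∀ (N : ℕ) (y : Fin N → E3), Function.Injective y →
    (∀ i j : Fin N, i ≠ j → δ ≤ dist (y i) (y j)) →
    (N : ℝ) * eStar + c * (Nat.card {i : Fin N //
        ¬ Capped ((Measure.count : Measure E3).restrict ((fun z => z - y i) '' Set.range y))} : ℝ) ≤
      interactionEnergy lennardJones y

/-! ## Sufficiency: the defect-surcharged transport -/

/-- **The finite cap inequality at hard core `δ` with constant `c > 0` yields the cap certificates at `δ` with margin
`c/2`** (composition of the five landed r3 stubs: measurable cap event, sent / received bookkeeping of the defect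
transport, surcharged periodisation, assembly). -/
theorem capCertificates_at_of_finite {δ c : ℝ} (hδ : 0 < δ) (hc : 0 < c)
    (hineq : ∀ (N : ℕ) (y : Fin N → E3), Function.Injective y →
      (∀ i j : Fin N, i ≠ j → δ ≤ dist (y i) (y j)) →
      (N : ℝ) * eStar + c * (Nat.card {i : Fin N //
          ¬ Capped ((Measure.count : Measure E3).restrict ((fun z => z - y i) '' Set.range y))} : ℝ) ≤
        interactionEnergy lennardJones y) :
    ∀ ε : ℝ, 0 < ε → ∃ R M : ℝ, ∃ t : Measure E3 → E3 → ℝ, IsTransfer R M t ∧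
      ∀ μ : Measure E3, IsRootedHardCore δ μ →
        eStar - ε ≤ rootEnergy lennardJones μ + transferDiv t μ ∧
        (¬ Capped μ → eStar + c / 2 ≤ rootEnergy lennardJones μ + transferDiv t μ) := by
  obtain ⟨B, hB, hBcap⟩ := CapEvent.stub_capEvent
  exact CapAssembly.stub_capAssembly B hB hBcap
    (fun c δ L hδ hL => DefectTransportSent.stub_defectTransportSent B hB c δ L hδ hL)
    (fun c δ L hδ hL => DefectTransportReceived.stub_defectTransportReceived B hB c δ L hδ hL)
    (fun c δ₀ δ L hc hδ₀ hle hL hE => SurchargedReceived.stub_surchargedReceived B c δ₀ δ L hc hδ₀ hle hL hE)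
    δ hδ c hc hineq

/-- **SUFFICIENCY: `FiniteCapInequality → CapCertificates`** (cap margin = half the finite constant). -/
theorem capCertificates_of_finiteCapInequality (hfin : FiniteCapInequality) : CapCertificates := by
  intro δ hδ
  obtain ⟨c, hc, hineq⟩ := hfin δ hδ
  exact ⟨c / 2, by positivity, capCertificates_at_of_finite hδ hc hineq⟩

/-! ## The three forms of the TCP-regime energy statement are equivalent -/

/-- **`FiniteCapInequality ↔ CapPricing`**: sufficiency through the certificates and Mecke pricing
(`Cap.capPricing_of_capCertificates`), necessity by exact uniform rooting (`Cap.finite_cap_inequality_of_capPricing`). -/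
theorem finiteCapInequality_iff_capPricing : FiniteCapInequality ↔ CapPricing :=
  ⟨fun h => capPricing_of_capCertificates (capCertificates_of_finiteCapInequality h),
   fun h => finite_cap_inequality_of_capPricing h⟩

/-- **`CapCertificates ↔ FiniteCapInequality`**: the pointwise hybrid certificates of the line exist if and only if the
finite linear cap inequality holds (the constants change by a factor `2` round the loop). -/
theorem capCertificates_iff_finiteCapInequality : CapCertificates ↔ FiniteCapInequality :=
  ⟨fun h => finite_cap_inequality_of_capPricing (capPricing_of_capCertificates h),
   capCertificates_of_finiteCapInequality⟩

/-- **`CapCertificates ↔ CapPricing`**. -/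
theorem capCertificates_iff_capPricing : CapCertificates ↔ CapPricing :=
  capCertificates_iff_finiteCapInequality.trans finiteCapInequality_iff_capPricing

/-! ## Consequences for the line and the crux -/

/-- **The periodic cap gap from the finite inequality**: some `c > 0` makes every periodic configuration with
`1/3`-separated points and at least `t·#motif` capless motif sites satisfy `e(Q) ≥ e* + c·t`. -/
theorem capGap_of_finiteCapInequality (hfin : FiniteCapInequality) :
    ∃ c : ℝ, 0 < c ∧ ∀ Q : PeriodicConfiguration 3, IsSepThird Q → ∀ t : ℝ,
      t * (Q.motif.card : ℝ) ≤ (caplessMotifCount Q : ℝ) →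
      eStar + c * t ≤ Q.energyPerParticle lennardJones :=
  capGap_of_capPricing (finiteCapInequality_iff_capPricing.1 hfin)

/-- **The hard-core periodic shell gap from the line's two open stubs**: `FiniteCapInequality` (TCP regime) and
`Cap.CappedRegimeShellGap` (capped regime) give `Residual.ShellGap 0`. -/
theorem shellGap_zero_of_finiteCapInequality (hfin : FiniteCapInequality) (h4 : CappedRegimeShellGap) : ShellGap 0 :=
  shellGap_zero_of_capPricing (finiteCapInequality_iff_capPricing.1 hfin) h4

/-- **The crux from the line's two open stubs** (the r3 reduction of line `octahedral-annulus-mandate`):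
`FiniteCapInequality → Cap.CappedRegimeShellGap → MinimiserShells`, through `Cap.cap_reduction` and the landed
sufficiency of the residual `Residual.minimiserShells_of_shellGap_zero`. -/
theorem minimiserShells_of_finiteCapInequality (hfin : FiniteCapInequality) (h4 : CappedRegimeShellGap) :
    MinimiserShells :=
  cap_reduction (capCertificates_of_finiteCapInequality hfin) h4

/-! ## Registered marker -/

/-- Registered sub-goal `stub_capSufficiency` (lead c10, line `octahedral-annulus-mandate`, reshape r3): the sufficiency
`FiniteCapInequality → Cap.CapCertificates` in closed form (the finite inequality unfolded). -/
theorem stub_capSufficiency : (∀ δ : ℝ, 0 < δ → ∃ c : ℝ, 0 < c ∧ ∀ (N : ℕ) (y : Fin N → E3), Function.Injective y → (∀ i j : Fin N, i ≠ j → δ ≤ dist (y i) (y j)) → (N : ℝ) * eStar + c * (Nat.card {i : Fin N // ¬ Capped ((Measure.count : Measure E3).restrict ((fun z => z - y i) '' Set.range y))} : ℝ) ≤ interactionEnergy lennardJones y) → Summit.AtomisticToContinuum.Crystallization.Theorems.PalmUnimodularRigidityMinimiserShells.Cap.CapCertificates :=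
  fun h => capCertificates_of_finiteCapInequality h

end Summit.AtomisticToContinuum.Crystallization.Theorems.PalmUnimodularRigidityMinimiserShells.CapSufficiency

end
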